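import Literature.AlgebraicGeometry.AbelianSchemes.PolarizedAbelianSchemeWithLevelBaseChangeUnique
import Literature.AlgebraicGeometry.AbelianSchemes.AbelianSchemeOverLevelBaseChange
import HarnessLib

/-!
# ASM (a): two base-change presentations of ONE abelian scheme over ONE base are isomorphic as group schemes, compatibly with the
# projections — iterated base changes along equal composites — and endomorphisms move across
# ([GortzWedhorn2020] Prop. 4.16, Section (4.7); [MumfordFogartyKirwan1994] Ch. 7 §2 Def. 7.2–7.3)

Topic `AlgebraicGeometry/AbelianSchemes`, namespace `Literature.AlgebraicGeometry.AbelianSchemes.AbelianSchemeOver`.  THEOREMS ONLY (no definition,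
no named fact, no instance, no notation, no `sorry`).  Cell `hodgecm-mathlib` (D-0151), FLOOR 0, P6 «MOD» (crux hLiu418 = stmt-HodgeConjecture-24832,
`--supports`), E6 closer of `Cruxes/HLiu418/Lines/F0_P6a_PELWitnessE.lean`, socket Σ-AN `ReadsCReading`, census row **ASM (a)** (A-p06 (g33)
`CENSUS-SigmaAN.v2`: «`(P_X.A.baseChange prX).baseChange ιq′` and `P_T.A` are both base changes of `univ.A` along EQUAL maps `T ⟶ 𝓜.M.left` ⇒ the
`IsMonHom` iso over `T`; conjugating `Y_q b` by it feeds ★ ASM (b) `exists_hom_of_isColimit_cofan`»).  HC_CM is proved only modulo the printed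
citations (2 remaining named inputs hLiu418 24832, h413 24833) until rung 0 closes; this file is generic and changes no count.

THE MATHEMATICS.  If `G₁ : A₁ → A` and `G₂ : A₂ → A` both exhibit abelian schemes `A₁, A₂` over `T` as the base change of `A → M` along the SAME
`k : T → M` (★ `AbelianSchemeOver.IsBaseChangeVia`), the comparison isomorphism `H : A₂ ≅ A₁` with `H ≫ G₁ = G₂` is an isomorphism of `T`-GROUP
schemes ([GortzWedhorn2020] Prop. 4.16: the pull-back is unique up to unique isomorphism; ★ `IsBaseChangeVia.exists_isBaseChangeVia_id` + the
`𝟙`-case read as an `Over`-isomorphism, [MumfordFogartyKirwan1994] Def. 7.3).  In particular the ITERATED base changes `((A ×_M S) ×_S T) [×_T U]`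
and `A ×_M U` along composable maps with `h ≫ g ≫ f = k` are isomorphic as group schemes over `U`, the isomorphism commuting with the projections
to `A` (§2), and an endomorphism `Y` of one presentation (a homomorphism) conjugates to an endomorphism `Y′ = e ≫ Y ≫ e⁻¹` of the other, a
homomorphism, with `Y′ ≫ e = e ≫ Y` and the point formula `Y′ ≫ G₂ = e ≫ Y ≫ G₁` on underlying schemes (§3) — what ★ ASM (b) and the reading
clause RD consume in Σ-AN.

* §1 `exists_isMonHom_iso_of_isBaseChangeVia` — two presentations along the same `k`: `∃ e : A₂.X ≅ A₁.X, IsMonHom e.hom ∧ e.hom.left ≫ G₁ = G₂`.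
* §2 `exists_isMonHom_iso_baseChange_baseChange`, `exists_isMonHom_iso_baseChange_baseChange_baseChange` — iterated base changes along
  `g ≫ f = k`, `h ≫ g ≫ f = k`, with the `fst`-formulas.
* §3 `exists_isMonHom_conj_of_iso` (generic conjugation with its two formulas) and the Σ-AN shape
  **`exists_isMonHom_conj_baseChange_baseChange_baseChange`**.

## References
* [GortzWedhorn2020] U. Görtz, T. Wedhorn, *Algebraic Geometry I* (2nd ed. 2020), Prop. 4.16 (p. 101), Section (4.7) (pp. 107–108).
* [MumfordFogartyKirwan1994] D. Mumford, J. Fogarty, F. Kirwan, *Geometric Invariant Theory*, 3rd ed. (1994), Ch. 7 §2 Definition 7.2 (p. 129),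
  Definition 7.3 (p. 130).
-/

set_option autoImplicit false

noncomputable section

universe u

open CategoryTheory CategoryTheory.Limits AlgebraicGeometry MonoidalCategory CartesianMonoidalCategory
open scoped MonObj

namespace Literature.AlgebraicGeometry.AbelianSchemes

namespace AbelianSchemeOver

/-! ### §0 The `𝟙`-case read as an `Over`-isomorphism of group schemes (private twin of ★ `exists_iso_of_isBaseChangeVia_id`, kept here to
spare this `AbelianSchemes` file the `ModuliOfAbelianVarieties` import) -/

/-- A base change along `𝟙 S` via `G` is an isomorphism `A′ ≅ A` of `S`-group schemes with underlying map `G`.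
[cite: MumfordFogartyKirwan1994, Ch. 7 §2 Definition 7.3 (p. 130)] -/
private theorem exists_iso_of_isBaseChangeVia_id' {S : Scheme.{u}} {A' A : AbelianSchemeOver S} {G : A'.X.left ⟶ A.X.left}
    (h : A'.IsBaseChangeVia A (𝟙 S) G) : ∃ e : A'.X ≅ A.X, e.hom.left = G ∧ IsMonHom e.hom := by
  obtain ⟨w, hpb, hunit, hmul⟩ := h
  haveI : IsIso G := hpb.isIso_fst_of_isIso
  have w' : G ≫ A.X.hom = A'.X.hom := by rw [w, Category.comp_id]
  refine ⟨Over.isoMk (asIso G) w', rfl, ⟨?_, ?_⟩⟩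
  · ext
    rw [Over.comp_left]
    change η[A'.X].left ≫ G = η[A.X].left
    rw [hunit, Category.id_comp]
  · ext
    rw [Over.comp_left, Over.comp_left, Over.tensorHom_left]
    exact hmul

/-! ### §1 Two presentations along the same map -/

variable {M T : Scheme.{u}} {A : AbelianSchemeOver M} {A₁ A₂ : AbelianSchemeOver T} {k : T ⟶ M}
  {G₁ : A₁.X.left ⟶ A.X.left} {G₂ : A₂.X.left ⟶ A.X.left}

/-- **Two base-change presentations of `A` over `T` along the same `k` are isomorphic as `T`-group schemes, compatibly with the projections to
`A`** ([GortzWedhorn2020] Prop. 4.16 + the `𝟙`-case of [MumfordFogartyKirwan1994] Def. 7.3): `∃ e : A₂.X ≅ A₁.X`, `IsMonHom e.hom`,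
`e.hom.left ≫ G₁ = G₂`. [cite: GortzWedhorn2020, Prop. 4.16 (p. 101)] [cite: MumfordFogartyKirwan1994, Ch. 7 §2 Definition 7.3 (p. 130)] -/
theorem exists_isMonHom_iso_of_isBaseChangeVia (h₁ : A₁.IsBaseChangeVia A k G₁) (h₂ : A₂.IsBaseChangeVia A k G₂) :
    ∃ e : A₂.X ≅ A₁.X, IsMonHom e.hom ∧ e.hom.left ≫ G₁ = G₂ := by
  obtain ⟨H, -, hHG, hH⟩ := h₁.exists_isBaseChangeVia_id h₂
  obtain ⟨e, he, hmon⟩ := exists_iso_of_isBaseChangeVia_id' hH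
  exact ⟨e, hmon, by rw [he]; exact hHG⟩

/-! ### §2 Iterated base changes along equal composites -/

/-- **`(A ×_M S) ×_S T ≅ A ×_M T` as `T`-group schemes when `g ≫ f = k`**, the isomorphism commuting with the projections to `A`:
`e.hom.left ≫ pr = pr ≫ pr`. [cite: GortzWedhorn2020, Section (4.7) (pp. 107–108) and Prop. 4.16 (p. 101)] -/
theorem exists_isMonHom_iso_baseChange_baseChange {S : Scheme.{u}} (A : AbelianSchemeOver M) (f : S ⟶ M) (g : T ⟶ S) (k : T ⟶ M)
    (hk : g ≫ f = k) :
    ∃ e : ((A.baseChange f).baseChange g).X ≅ (A.baseChange k).X, IsMonHom e.hom ∧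
      e.hom.left ≫ pullback.fst A.X.hom k = pullback.fst (pullback.snd A.X.hom f) g ≫ pullback.fst A.X.hom f := by
  have h₂ : ((A.baseChange f).baseChange g).IsBaseChangeVia A k
      (pullback.fst (pullback.snd A.X.hom f) g ≫ pullback.fst A.X.hom f) := by
    have h := ((A.baseChange f).baseChange_isBaseChangeVia g).trans (A.baseChange_isBaseChangeVia f)
    rwa [hk] at h
  exact exists_isMonHom_iso_of_isBaseChangeVia (A.baseChange_isBaseChangeVia k) h₂

/-- **`((A ×_M S) ×_S T) ×_T U ≅ A ×_M U` as `U`-group schemes when `h ≫ g ≫ f = k`**, commuting with the projections to `A`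
(the Σ-AN shape: `A := univ.A`, `f := φ₂`, `g := prX`, `h := ι_q′`, `k := φ₁`). [cite: GortzWedhorn2020, Section (4.7) (pp. 107–108) and Prop. 4.16 (p. 101)] -/
theorem exists_isMonHom_iso_baseChange_baseChange_baseChange {S U : Scheme.{u}} (A : AbelianSchemeOver M) (f : S ⟶ M) (g : T ⟶ S)
    (h : U ⟶ T) (k : U ⟶ M) (hk : h ≫ g ≫ f = k) :
    ∃ e : (((A.baseChange f).baseChange g).baseChange h).X ≅ (A.baseChange k).X, IsMonHom e.hom ∧
      e.hom.left ≫ pullback.fst A.X.hom k =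
        pullback.fst (pullback.snd (pullback.snd A.X.hom f) g) h ≫ pullback.fst (pullback.snd A.X.hom f) g ≫ pullback.fst A.X.hom f := by
  have h₂ : (((A.baseChange f).baseChange g).baseChange h).IsBaseChangeVia A k
      (pullback.fst (pullback.snd (pullback.snd A.X.hom f) g) h ≫ pullback.fst (pullback.snd A.X.hom f) g ≫ pullback.fst A.X.hom f) := by
    have h' := ((((A.baseChange f).baseChange g).baseChange_isBaseChangeVia h).trans
      ((A.baseChange f).baseChange_isBaseChangeVia g)).trans (A.baseChange_isBaseChangeVia f)
    rw [Category.assoc] at h'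
    rwa [hk] at h'
  exact exists_isMonHom_iso_of_isBaseChangeVia (A.baseChange_isBaseChangeVia k) h₂

/-! ### §3 Endomorphisms move across -/

/-- **Conjugating an endomorphism through an isomorphism of group schemes over one base**: for `e : A₂.X ≅ A₁.X` with `IsMonHom e.hom` and an
endomorphism `Y` of `A₁` which is a homomorphism, `Y′ := e.hom ≫ Y ≫ e.inv` is an endomorphism of `A₂`, a homomorphism, with `Y′ ≫ e.hom = e.hom ≫ Y`
and, on underlying schemes, `Y′.left ≫ e.hom.left = e.hom.left ≫ Y.left`. [cite: MumfordFogartyKirwan1994, Ch. 6 §1 Definition 6.1 (p. 115)] -/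
theorem exists_isMonHom_conj_of_iso (e : A₂.X ≅ A₁.X) [IsMonHom e.hom] (Y : A₁.X ⟶ A₁.X) [IsMonHom Y] :
    ∃ Y' : A₂.X ⟶ A₂.X, IsMonHom Y' ∧ Y' = e.hom ≫ Y ≫ e.inv ∧ Y' ≫ e.hom = e.hom ≫ Y ∧
      Y'.left ≫ e.hom.left = e.hom.left ≫ Y.left := by
  haveI : IsMonHom e.inv := inferInstance
  refine ⟨e.hom ≫ Y ≫ e.inv, inferInstance, rfl, by simp only [Category.assoc, e.inv_hom_id, Category.comp_id], ?_⟩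
  rw [← Over.comp_left, ← Over.comp_left]
  simp only [Category.assoc, e.inv_hom_id, Category.comp_id]

/-- **ASM (a), Σ-AN SHAPE — AN ENDOMORPHISM OF `A ×_M U` (along `k`) MOVES TO THE ITERATED BASE CHANGE `((A ×_M S) ×_S T) ×_T U` (along
`h ≫ g ≫ f = k`)**: for a homomorphism `Y : (A.baseChange k).X ⟶ (A.baseChange k).X` there are an `IsMonHom` iso `e` as in §2 and a homomorphism
`Y′` of the iterated base change with `Y′ ≫ e.hom = e.hom ≫ Y` and the point formula `Y′.left ≫ (pr ≫ pr ≫ pr) = e.hom.left ≫ Y.left ≫ pr` into `A`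
— in Σ-AN `Y := Y_q b` (★ COV-6) and `Y′` is the leg endomorphism ★ ASM (b) `exists_hom_of_isColimit_cofan` glues.
[cite: GortzWedhorn2020, Section (4.7) (pp. 107–108) and Prop. 4.16 (p. 101)] [cite: MumfordFogartyKirwan1994, Ch. 6 §1 Definition 6.1 (p. 115)] -/
theorem exists_isMonHom_conj_baseChange_baseChange_baseChange {S U : Scheme.{u}} (A : AbelianSchemeOver M) (f : S ⟶ M) (g : T ⟶ S)
    (h : U ⟶ T) (k : U ⟶ M) (hk : h ≫ g ≫ f = k) (Y : (A.baseChange k).X ⟶ (A.baseChange k).X) [IsMonHom Y] :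
    ∃ (e : (((A.baseChange f).baseChange g).baseChange h).X ≅ (A.baseChange k).X)
      (Y' : (((A.baseChange f).baseChange g).baseChange h).X ⟶ (((A.baseChange f).baseChange g).baseChange h).X),
      IsMonHom e.hom ∧ IsMonHom Y' ∧
      e.hom.left ≫ pullback.fst A.X.hom k =
        pullback.fst (pullback.snd (pullback.snd A.X.hom f) g) h ≫ pullback.fst (pullback.snd A.X.hom f) g ≫ pullback.fst A.X.hom f ∧
      Y' ≫ e.hom = e.hom ≫ Y ∧
      Y'.left ≫ (pullback.fst (pullback.snd (pullback.snd A.X.hom f) g) h ≫ pullback.fst (pullback.snd A.X.hom f) g ≫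
          pullback.fst A.X.hom f) = e.hom.left ≫ Y.left ≫ pullback.fst A.X.hom k := by
  obtain ⟨e, he, hfst⟩ := exists_isMonHom_iso_baseChange_baseChange_baseChange A f g h k hk
  haveI := he
  obtain ⟨Y', hY', -, hcomm, hleft⟩ := exists_isMonHom_conj_of_iso e Y
  refine ⟨e, Y', he, hY', hfst, hcomm, ?_⟩
  have h1 : Y'.left ≫ e.hom.left ≫ pullback.fst A.X.hom k = e.hom.left ≫ Y.left ≫ pullback.fst A.X.hom k := by
    rw [← Category.assoc, hleft, Category.assoc]
  have h2 : Y'.left ≫ e.hom.left ≫ pullback.fst A.X.hom k =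
      Y'.left ≫ (pullback.fst (pullback.snd (pullback.snd A.X.hom f) g) h ≫ pullback.fst (pullback.snd A.X.hom f) g ≫
        pullback.fst A.X.hom f) := congrArg (fun x => Y'.left ≫ x) hfst
  exact h2.symm.trans h1

end AbelianSchemeOver

end Literature.AlgebraicGeometry.AbelianSchemes

end
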